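import Summits.NavierStokesRegularity.NavierStokesRegularity.Theorems.PoloidalWindowDoorPoloidalWindowRigidityZShockRotatingProfileAngularMomentum
import HarnessLib

/-!
# Crux K2 `PoloidalWindowRigidity` (stmt-NavierStokesRegularity-19708), line `z_shock` — R3 inhabitant census: ROTATING PATTERNS of the
# autonomous thick height-evolution (VI) — the ENERGY LAW of the radius-as-time problem on circles (the non-autonomous forcing made explicit)

`--supports stmt-NavierStokesRegularity-19708 --as helper` (leafhand-ns-poloidalwindowdoor-3 g9, cell decomp-ns, 2026-08-31).  Class-free,
def-free; Mathlib + parts I/II/IV/V (`…ZShockRotatingProfile{,LogPolar,Flux,AngularMomentum}`).  **No stub and no summit is closed by this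
file; Navier–Stokes regularity is NOT proved here (rung 0).**

WHY THIS FILE.  Part V landed the EXACT angular-momentum law of the exterior radius-as-time problem of a rotating pattern
(`X(γ(Ψ)XΨ) = Θ((ω²|y|² − γ(Ψ))ΘΨ)`, `XΨ(y) = DΨ(y)[y]`, `ΘΨ(y) = DΨ(y)[Jy]`).  The companion ENERGY law (evidence #46 §2(c), brick F2) is NOT
exact: reading the radius as time, the drift `ω²|y|²` grows along the flow and PUMPS energy into the angular gradient at the rate
`ω²|y|² (ΘΨ)²·(X log|y|²) = 2ω²|y|²(ΘΨ)²` per unit `ρ = log|y|`, besides the cubic genuinely nonlinear exchange term.  This file makes both terms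
explicit, so that a LEAD's cumulative-steepening argument (evidence #46 §3, F3–F4) starts from kernel identities:

* `fderiv_normSq_radial` — `D(|·|²)(x)[x] = 2|x|²`;  `norm_polar_sq` — `|P r α|² = r²`;
* ★ `energy_identity` — **pointwise law**: for a `C²` solution of the profile equation (`γ ∈ C¹`), with `m = ω²|·|² − γ(Ψ)`,
  `X(½[γ(Ψ)(XΨ)² + m (ΘΨ)²]) = Θ(m·ΘΨ·XΨ) + ω²|x|²(ΘΨ)² − ½ γ'(Ψ)·XΨ·((ΘΨ)² + (XΨ)²)`
  (log-polar: `∂_ρ ½[γΨ_ρ² + (ω²e^{2ρ} − γ)Ψ_θ²] = ∂_θ((ω²e^{2ρ} − γ)Ψ_θΨ_ρ) + ω²e^{2ρ}Ψ_θ² − ½γ'(Ψ)Ψ_ρ(Ψ_θ² + Ψ_ρ²)`);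
* ★ `circle_energy_law` — **integrated law**: with `P r α = (r cos α, r sin α)`, `u α = (cos α, sin α)`, for every `r`,
  `r · ∫₀^{2π} D(½[γ(XΨ)² + m(ΘΨ)²])(P r α)[u α] dα = ω² r² ∫₀^{2π} (ΘΨ)²(P r α) dα − ½ ∫₀^{2π} (γ'(Ψ)·XΨ·((ΘΨ)² + (XΨ)²))(P r α) dα`
  (the left integral is the radial derivative of the circle energy `∫₀^{2π} ½[γ(XΨ)² + m(ΘΨ)²](P r α) dα`, `hasDerivAt_circle_energy`).
  Outside the sonic circle the circle energy is nonnegative and, in the linearly degenerate case `γ' ≡ 0`, NON-DECREASING in the radius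
  with growth rate exactly `ω² r ∮(ΘΨ)²` — the outgoing spiral-wave flux of evidence #46 §2(b).

Elementary (product rules, parts IV–V); no rigidity is proved.  presearch: none needed beyond parts I–V. [folklore]
-/

noncomputable section

namespace Summit.NavierStokesRegularity.NavierStokesRegularity.Theorems.PoloidalWindowDoorPoloidalWindowRigidityZShockRotatingProfileEnergy

-- the summit and its single sub-problem share the name (CONVENTIONS §1)
set_option linter.dupNamespace false

open Set Filter Topology Function MeasureTheory intervalIntegral
open Summit.NavierStokesRegularity.NavierStokesRegularity.Theorems.PoloidalWindowDoorPoloidalWindowRigidityZShockRotatingProfile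
open Summit.NavierStokesRegularity.NavierStokesRegularity.Theorems.PoloidalWindowDoorPoloidalWindowRigidityZShockRotatingProfileLogPolar
open Summit.NavierStokesRegularity.NavierStokesRegularity.Theorems.PoloidalWindowDoorPoloidalWindowRigidityZShockRotatingProfileFlux
open Summit.NavierStokesRegularity.NavierStokesRegularity.Theorems.PoloidalWindowDoorPoloidalWindowRigidityZShockRotatingProfileAngularMomentum

variable {Ψ : EuclideanSpace ℝ (Fin 2) → ℝ} {γ : ℝ → ℝ} {ω : ℝ}
  {J : EuclideanSpace ℝ (Fin 2) → EuclideanSpace ℝ (Fin 2)} {P : ℝ → ℝ → EuclideanSpace ℝ (Fin 2)} {u : ℝ → EuclideanSpace ℝ (Fin 2)}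

/-! ### Two norm identities -/

/-- **`D(|·|²)(x)[x] = 2|x|²`** (Euler's identity for the quadratic form). [folklore] -/
theorem fderiv_normSq_radial (x : EuclideanSpace ℝ (Fin 2)) :
    fderiv ℝ (fun x' : EuclideanSpace ℝ (Fin 2) => ‖x'‖ ^ 2) x x = 2 * ‖x‖ ^ 2 := by
  have hnorm : ∀ x' : EuclideanSpace ℝ (Fin 2), ‖x'‖ ^ 2 = x' 0 * x' 0 + x' 1 * x' 1 := by
    intro x'
    rw [EuclideanSpace.norm_eq, Real.sq_sqrt (Finset.sum_nonneg fun i _ => sq_nonneg _), Fin.sum_univ_two]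
    simp [Real.norm_eq_abs, sq]
  have hnfun : (fun x' : EuclideanSpace ℝ (Fin 2) => ‖x'‖ ^ 2) = fun x' => x' 0 * x' 0 + x' 1 * x' 1 := funext hnorm
  have hP0 := hasFDerivAt_coord_zero x
  have hP1 := hasFDerivAt_coord_one x
  have hn : HasFDerivAt (fun x' : EuclideanSpace ℝ (Fin 2) => x' 0 * x' 0 + x' 1 * x' 1)
      (x 0 • (EuclideanSpace.proj (𝕜 := ℝ) (0 : Fin 2) : EuclideanSpace ℝ (Fin 2) →L[ℝ] ℝ) +
        x 0 • (EuclideanSpace.proj (𝕜 := ℝ) (0 : Fin 2) : EuclideanSpace ℝ (Fin 2) →L[ℝ] ℝ) +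
        (x 1 • (EuclideanSpace.proj (𝕜 := ℝ) (1 : Fin 2) : EuclideanSpace ℝ (Fin 2) →L[ℝ] ℝ) +
          x 1 • (EuclideanSpace.proj (𝕜 := ℝ) (1 : Fin 2) : EuclideanSpace ℝ (Fin 2) →L[ℝ] ℝ))) x :=
    (hP0.mul hP0).add (hP1.mul hP1)
  rw [hnfun, hn.fderiv, hnorm x]
  simp only [add_apply, smul_apply, smul_eq_mul, proj_zero_apply, proj_one_apply]
  ring

/-- **`|P(r, α)|² = r²`**. [folklore] -/
theorem norm_polar_sq
    (hP : ∀ r α, P r α = (r * Real.cos α) • EuclideanSpace.single (0 : Fin 2) (1 : ℝ) + (r * Real.sin α) • EuclideanSpace.single (1 : Fin 2) (1 : ℝ))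
    (r α : ℝ) : ‖P r α‖ ^ 2 = r ^ 2 := by
  have hcs := Real.cos_sq_add_sin_sq α
  rw [EuclideanSpace.norm_eq, Real.sq_sqrt (Finset.sum_nonneg fun i _ => sq_nonneg _), Fin.sum_univ_two, Real.norm_eq_abs,
    Real.norm_eq_abs, sq_abs, sq_abs, polar_apply_zero hP, polar_apply_one hP]
  linear_combination r ^ 2 * hcs

/-! ### The energy law -/

/-- ★ **The pointwise energy law.**  Let the `C²` profile `Ψ` solve the rotating-pattern equation `ω² ΘΘΨ = Σᵢ ∂ᵢ(γ(Ψ)∂ᵢΨ)` (`γ ∈ C¹`),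
and write `m = ω²|·|² − γ(Ψ)`.  Then at every `x`:
`X(½[γ(Ψ)(XΨ)² + m(ΘΨ)²])(x) = Θ(m·ΘΨ·XΨ)(x) + ω²|x|²(ΘΨ x)² − ½ γ'(Ψ x)·XΨ(x)·((ΘΨ x)² + (XΨ x)²)`.
Proof: product rules, the radius-as-time equation `X(γXΨ) = Θ(mΘΨ)`, the commutation `X(ΘΨ) = Θ(XΨ)` and `X(|·|²) = 2|·|²`. [folklore] -/
theorem energy_identity (hΨ : ContDiff ℝ 2 Ψ) (hγ : ContDiff ℝ 1 γ)
    (hJ : ∀ y' : EuclideanSpace ℝ (Fin 2), J y' = (-(y' 1)) • EuclideanSpace.single (0 : Fin 2) (1 : ℝ) +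
      (y' 0) • EuclideanSpace.single (1 : Fin 2) (1 : ℝ))
    (hrot : ∀ y : EuclideanSpace ℝ (Fin 2),
      ω ^ 2 * fderiv ℝ (fun y' => fderiv ℝ Ψ y' (J y')) y (J y) =
        ∑ i, fderiv ℝ (fun y' => γ (Ψ y') * fderiv ℝ Ψ y' (EuclideanSpace.single i 1)) y (EuclideanSpace.single i 1))
    (x : EuclideanSpace ℝ (Fin 2)) :
    fderiv ℝ (fun x' => (1 / 2 : ℝ) * (γ (Ψ x') * fderiv ℝ Ψ x' x' ^ 2 +
        (ω ^ 2 * ‖x'‖ ^ 2 - γ (Ψ x')) * fderiv ℝ Ψ x' (J x') ^ 2)) x x =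
      fderiv ℝ (fun x' => (ω ^ 2 * ‖x'‖ ^ 2 - γ (Ψ x')) * fderiv ℝ Ψ x' (J x') * fderiv ℝ Ψ x' x') x (J x) +
        ω ^ 2 * ‖x‖ ^ 2 * fderiv ℝ Ψ x (J x) ^ 2 -
        (1 / 2 : ℝ) * deriv γ (Ψ x) * fderiv ℝ Ψ x x * (fderiv ℝ Ψ x (J x) ^ 2 + fderiv ℝ Ψ x x ^ 2) := by
  -- regularity
  have hJ' : J = fun y' => (-(y' 1)) • EuclideanSpace.single (0 : Fin 2) (1 : ℝ) +
      (y' 0) • EuclideanSpace.single (1 : Fin 2) (1 : ℝ) := funext hJ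
  have hJc : ContDiff ℝ 1 J := by rw [hJ']; fun_prop
  have hΨd : Differentiable ℝ Ψ := hΨ.differentiable two_ne_zero
  have hDΨ : ContDiff ℝ 1 (fderiv ℝ Ψ) := hΨ.fderiv_right (m := 1) le_rfl
  have hγd : Differentiable ℝ γ := hγ.differentiable one_ne_zero
  have hXd : Differentiable ℝ fun x' => fderiv ℝ Ψ x' x' := (hDΨ.clm_apply contDiff_id).differentiable one_ne_zero
  have hΘd : Differentiable ℝ fun x' => fderiv ℝ Ψ x' (J x') := (hDΨ.clm_apply hJc).differentiable one_ne_zero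
  have hnd : Differentiable ℝ fun x' : EuclideanSpace ℝ (Fin 2) => ‖x'‖ ^ 2 := (contDiff_norm_sq ℝ (n := 1)).differentiable one_ne_zero
  have hg : HasFDerivAt (fun x' => γ (Ψ x')) (deriv γ (Ψ x) • fderiv ℝ Ψ x) x :=
    (hγd (Ψ x)).hasDerivAt.comp_hasFDerivAt x (hΨd x).hasFDerivAt
  have hX' : HasFDerivAt (fun x' => fderiv ℝ Ψ x' x') (fderiv ℝ (fun x' => fderiv ℝ Ψ x' x') x) x := (hXd x).hasFDerivAt
  have hΘ' : HasFDerivAt (fun x' => fderiv ℝ Ψ x' (J x')) (fderiv ℝ (fun x' => fderiv ℝ Ψ x' (J x')) x) x := (hΘd x).hasFDerivAt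
  have hn' : HasFDerivAt (fun x' : EuclideanSpace ℝ (Fin 2) => ‖x'‖ ^ 2) (fderiv ℝ (fun x' : EuclideanSpace ℝ (Fin 2) => ‖x'‖ ^ 2) x) x :=
    (hnd x).hasFDerivAt
  have hm : HasFDerivAt (fun x' => ω ^ 2 * ‖x'‖ ^ 2 - γ (Ψ x'))
      (ω ^ 2 • fderiv ℝ (fun x' : EuclideanSpace ℝ (Fin 2) => ‖x'‖ ^ 2) x - deriv γ (Ψ x) • fderiv ℝ Ψ x) x :=
    (hn'.const_mul (ω ^ 2)).sub hg
  -- the radial flux `γ(Ψ)·XΨ` (for the radius-as-time equation) and the angular flux `m·ΘΨ`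
  have hA : HasFDerivAt (fun x' => γ (Ψ x') * fderiv ℝ Ψ x' x')
      (γ (Ψ x) • fderiv ℝ (fun x' => fderiv ℝ Ψ x' x') x + fderiv ℝ Ψ x x • (deriv γ (Ψ x) • fderiv ℝ Ψ x)) x :=
    hg.mul hX'
  have hB : HasFDerivAt (fun x' => (ω ^ 2 * ‖x'‖ ^ 2 - γ (Ψ x')) * fderiv ℝ Ψ x' (J x'))
      ((ω ^ 2 * ‖x‖ ^ 2 - γ (Ψ x)) • fderiv ℝ (fun x' => fderiv ℝ Ψ x' (J x')) x +
        fderiv ℝ Ψ x (J x) • (ω ^ 2 • fderiv ℝ (fun x' : EuclideanSpace ℝ (Fin 2) => ‖x'‖ ^ 2) x - deriv γ (Ψ x) • fderiv ℝ Ψ x)) x :=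
    hm.mul hΘ'
  -- the left-hand side density
  have hLfun : (fun x' => (1 / 2 : ℝ) * (γ (Ψ x') * fderiv ℝ Ψ x' x' ^ 2 +
      (ω ^ 2 * ‖x'‖ ^ 2 - γ (Ψ x')) * fderiv ℝ Ψ x' (J x') ^ 2)) = fun x' => (1 / 2 : ℝ) * (γ (Ψ x') *
        (fderiv ℝ Ψ x' x' * fderiv ℝ Ψ x' x') + (ω ^ 2 * ‖x'‖ ^ 2 - γ (Ψ x')) * (fderiv ℝ Ψ x' (J x') * fderiv ℝ Ψ x' (J x'))) := by
    funext x'; ring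
  have hL : HasFDerivAt (fun x' => (1 / 2 : ℝ) * (γ (Ψ x') *
        (fderiv ℝ Ψ x' x' * fderiv ℝ Ψ x' x') + (ω ^ 2 * ‖x'‖ ^ 2 - γ (Ψ x')) * (fderiv ℝ Ψ x' (J x') * fderiv ℝ Ψ x' (J x'))))
      ((1 / 2 : ℝ) • ((γ (Ψ x) • (fderiv ℝ Ψ x x • fderiv ℝ (fun x' => fderiv ℝ Ψ x' x') x +
          fderiv ℝ Ψ x x • fderiv ℝ (fun x' => fderiv ℝ Ψ x' x') x) +
          (fderiv ℝ Ψ x x * fderiv ℝ Ψ x x) • (deriv γ (Ψ x) • fderiv ℝ Ψ x)) +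
        ((ω ^ 2 * ‖x‖ ^ 2 - γ (Ψ x)) • (fderiv ℝ Ψ x (J x) • fderiv ℝ (fun x' => fderiv ℝ Ψ x' (J x')) x +
          fderiv ℝ Ψ x (J x) • fderiv ℝ (fun x' => fderiv ℝ Ψ x' (J x')) x) +
          (fderiv ℝ Ψ x (J x) * fderiv ℝ Ψ x (J x)) •
            (ω ^ 2 • fderiv ℝ (fun x' : EuclideanSpace ℝ (Fin 2) => ‖x'‖ ^ 2) x - deriv γ (Ψ x) • fderiv ℝ Ψ x)))) x :=
    ((hg.mul (hX'.mul hX')).add (hm.mul (hΘ'.mul hΘ'))).const_mul (1 / 2 : ℝ)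
  -- the right-hand side flux `m·ΘΨ·XΨ`
  have hR : HasFDerivAt (fun x' => (ω ^ 2 * ‖x'‖ ^ 2 - γ (Ψ x')) * fderiv ℝ Ψ x' (J x') * fderiv ℝ Ψ x' x')
      (((ω ^ 2 * ‖x‖ ^ 2 - γ (Ψ x)) * fderiv ℝ Ψ x (J x)) • fderiv ℝ (fun x' => fderiv ℝ Ψ x' x') x +
        fderiv ℝ Ψ x x • fderiv ℝ (fun x' => (ω ^ 2 * ‖x'‖ ^ 2 - γ (Ψ x')) * fderiv ℝ Ψ x' (J x')) x) x :=
    hB.differentiableAt.hasFDerivAt.mul hX'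
  -- the structural inputs
  have hpde := rotating_profile_equation_logpolar hΨ hγ hJ hrot x
  have hsym := radial_angular_commute hΨ hJ x
  have hnr := fderiv_normSq_radial x
  rw [hA.fderiv] at hpde
  rw [hLfun, hL.fderiv, hR.fderiv]
  simp only [add_apply, sub_apply, smul_apply, smul_eq_mul] at hpde ⊢
  rw [hnr, ← hpde, hsym]
  ring

/-! ### The energy law on circles -/

/-- **Radial derivative of the circle energy** (dominated differentiation, part IV). [folklore] -/
theorem hasDerivAt_circle_energy (hΨ : ContDiff ℝ 2 Ψ) (hγ : ContDiff ℝ 1 γ)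
    (hJ : ∀ y' : EuclideanSpace ℝ (Fin 2), J y' = (-(y' 1)) • EuclideanSpace.single (0 : Fin 2) (1 : ℝ) +
      (y' 0) • EuclideanSpace.single (1 : Fin 2) (1 : ℝ))
    (hP : ∀ r α, P r α = (r * Real.cos α) • EuclideanSpace.single (0 : Fin 2) (1 : ℝ) + (r * Real.sin α) • EuclideanSpace.single (1 : Fin 2) (1 : ℝ))
    (hu : ∀ α, u α = Real.cos α • EuclideanSpace.single (0 : Fin 2) (1 : ℝ) + Real.sin α • EuclideanSpace.single (1 : Fin 2) (1 : ℝ))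
    (r : ℝ) :
    HasDerivAt (fun r' => ∫ α in (0 : ℝ)..2 * Real.pi, (1 / 2 : ℝ) * (γ (Ψ (P r' α)) * fderiv ℝ Ψ (P r' α) (P r' α) ^ 2 +
        (ω ^ 2 * ‖P r' α‖ ^ 2 - γ (Ψ (P r' α))) * fderiv ℝ Ψ (P r' α) (J (P r' α)) ^ 2))
      (∫ α in (0 : ℝ)..2 * Real.pi, fderiv ℝ (fun x' => (1 / 2 : ℝ) * (γ (Ψ x') * fderiv ℝ Ψ x' x' ^ 2 +
        (ω ^ 2 * ‖x'‖ ^ 2 - γ (Ψ x')) * fderiv ℝ Ψ x' (J x') ^ 2)) (P r α) (u α)) r := by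
  have hJ' : J = fun y' => (-(y' 1)) • EuclideanSpace.single (0 : Fin 2) (1 : ℝ) +
      (y' 0) • EuclideanSpace.single (1 : Fin 2) (1 : ℝ) := funext hJ
  have hJc : ContDiff ℝ 1 J := by rw [hJ']; fun_prop
  have hΨ1 : ContDiff ℝ 1 Ψ := hΨ.of_le one_le_two
  have hDΨ : ContDiff ℝ 1 (fderiv ℝ Ψ) := hΨ.fderiv_right (m := 1) le_rfl
  have hγΨ : ContDiff ℝ 1 fun y' => γ (Ψ y') := hγ.comp hΨ1
  have hE : ContDiff ℝ 1 fun x' => (1 / 2 : ℝ) * (γ (Ψ x') * fderiv ℝ Ψ x' x' ^ 2 +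
      (ω ^ 2 * ‖x'‖ ^ 2 - γ (Ψ x')) * fderiv ℝ Ψ x' (J x') ^ 2) :=
    contDiff_const.mul ((hγΨ.mul ((hDΨ.clm_apply contDiff_id).pow 2)).add
      (((contDiff_const.mul (contDiff_norm_sq ℝ (n := 1))).sub hγΨ).mul ((hDΨ.clm_apply hJc).pow 2)))
  exact hasDerivAt_circleIntegral hE hP hu r

/-- ★ **The energy law on circles.**  Let the `C²` profile `Ψ` solve the rotating-pattern equation (`γ ∈ C¹`), `m = ω²|·|² − γ(Ψ)`.  Then for
every radius `r`:
`r · ∫₀^{2π} D(½[γ(XΨ)² + m(ΘΨ)²])(P r α)[u α] dα = ω² r² ∫₀^{2π} (ΘΨ)²(P r α) dα − ½ ∫₀^{2π} (γ'(Ψ)·XΨ·((ΘΨ)² + (XΨ)²))(P r α) dα`: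
the circle energy of the radius-as-time problem grows at the rate of the outgoing angular flux `ω² r ∮(ΘΨ)²` (non-autonomous pumping by
the growing drift) up to the cubic genuinely nonlinear exchange term. [folklore] -/
theorem circle_energy_law (hΨ : ContDiff ℝ 2 Ψ) (hγ : ContDiff ℝ 1 γ)
    (hJ : ∀ y' : EuclideanSpace ℝ (Fin 2), J y' = (-(y' 1)) • EuclideanSpace.single (0 : Fin 2) (1 : ℝ) +
      (y' 0) • EuclideanSpace.single (1 : Fin 2) (1 : ℝ))
    (hP : ∀ r α, P r α = (r * Real.cos α) • EuclideanSpace.single (0 : Fin 2) (1 : ℝ) + (r * Real.sin α) • EuclideanSpace.single (1 : Fin 2) (1 : ℝ))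
    (hu : ∀ α, u α = Real.cos α • EuclideanSpace.single (0 : Fin 2) (1 : ℝ) + Real.sin α • EuclideanSpace.single (1 : Fin 2) (1 : ℝ))
    (hrot : ∀ y : EuclideanSpace ℝ (Fin 2),
      ω ^ 2 * fderiv ℝ (fun y' => fderiv ℝ Ψ y' (J y')) y (J y) =
        ∑ i, fderiv ℝ (fun y' => γ (Ψ y') * fderiv ℝ Ψ y' (EuclideanSpace.single i 1)) y (EuclideanSpace.single i 1))
    (r : ℝ) :
    r * ∫ α in (0 : ℝ)..2 * Real.pi, fderiv ℝ (fun x' => (1 / 2 : ℝ) * (γ (Ψ x') * fderiv ℝ Ψ x' x' ^ 2 +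
        (ω ^ 2 * ‖x'‖ ^ 2 - γ (Ψ x')) * fderiv ℝ Ψ x' (J x') ^ 2)) (P r α) (u α) =
      ω ^ 2 * r ^ 2 * (∫ α in (0 : ℝ)..2 * Real.pi, fderiv ℝ Ψ (P r α) (J (P r α)) ^ 2) -
        (1 / 2 : ℝ) * ∫ α in (0 : ℝ)..2 * Real.pi, deriv γ (Ψ (P r α)) * fderiv ℝ Ψ (P r α) (P r α) *
          (fderiv ℝ Ψ (P r α) (J (P r α)) ^ 2 + fderiv ℝ Ψ (P r α) (P r α) ^ 2) := by
  -- regularity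
  have hJ' : J = fun y' => (-(y' 1)) • EuclideanSpace.single (0 : Fin 2) (1 : ℝ) +
      (y' 0) • EuclideanSpace.single (1 : Fin 2) (1 : ℝ) := funext hJ
  have hJc : ContDiff ℝ 1 J := by rw [hJ']; fun_prop
  have hΨ1 : ContDiff ℝ 1 Ψ := hΨ.of_le one_le_two
  have hDΨ : ContDiff ℝ 1 (fderiv ℝ Ψ) := hΨ.fderiv_right (m := 1) le_rfl
  have hγΨ : ContDiff ℝ 1 fun y' => γ (Ψ y') := hγ.comp hΨ1
  have hXc : ContDiff ℝ 1 fun x' => fderiv ℝ Ψ x' x' := hDΨ.clm_apply contDiff_id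
  have hΘc : ContDiff ℝ 1 fun x' => fderiv ℝ Ψ x' (J x') := hDΨ.clm_apply hJc
  have hmc : ContDiff ℝ 1 fun x' => ω ^ 2 * ‖x'‖ ^ 2 - γ (Ψ x') := (contDiff_const.mul (contDiff_norm_sq ℝ (n := 1))).sub hγΨ
  have hF : ContDiff ℝ 1 fun x' => (ω ^ 2 * ‖x'‖ ^ 2 - γ (Ψ x')) * fderiv ℝ Ψ x' (J x') * fderiv ℝ Ψ x' x' := (hmc.mul hΘc).mul hXc
  have hPc : Continuous fun α => P r α := (continuous_polar hP).comp (continuous_const.prodMk continuous_id)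
  have hJcont : Continuous J := hJc.continuous
  have hΘP : Continuous fun α => fderiv ℝ Ψ (P r α) (J (P r α)) := hΘc.continuous.comp hPc
  have hXP : Continuous fun α => fderiv ℝ Ψ (P r α) (P r α) := hXc.continuous.comp hPc
  have hγ'c : Continuous (deriv γ) := hγ.continuous_deriv le_rfl
  -- pull the constants inside and use the pointwise law at `P r α` (`P = r • u`, `|P|² = r²`)
  rw [← intervalIntegral.integral_const_mul, ← intervalIntegral.integral_const_mul, ← intervalIntegral.integral_const_mul]
  have h1 : (fun α => r * fderiv ℝ (fun x' => (1 / 2 : ℝ) * (γ (Ψ x') * fderiv ℝ Ψ x' x' ^ 2 +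
      (ω ^ 2 * ‖x'‖ ^ 2 - γ (Ψ x')) * fderiv ℝ Ψ x' (J x') ^ 2)) (P r α) (u α)) =
      fun α => fderiv ℝ (fun x' => (ω ^ 2 * ‖x'‖ ^ 2 - γ (Ψ x')) * fderiv ℝ Ψ x' (J x') * fderiv ℝ Ψ x' x') (P r α) (J (P r α)) +
        (ω ^ 2 * r ^ 2 * fderiv ℝ Ψ (P r α) (J (P r α)) ^ 2 -
          (1 / 2 : ℝ) * (deriv γ (Ψ (P r α)) * fderiv ℝ Ψ (P r α) (P r α) *
            (fderiv ℝ Ψ (P r α) (J (P r α)) ^ 2 + fderiv ℝ Ψ (P r α) (P r α) ^ 2))) := by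
    funext α
    rw [← smul_eq_mul (a := r), ← map_smul, ← polar_eq_smul hP hu r α, energy_identity hΨ hγ hJ hrot (P r α), norm_polar_sq hP]
    ring
  rw [h1]
  have hint1 : IntervalIntegrable (fun α => fderiv ℝ (fun x' => (ω ^ 2 * ‖x'‖ ^ 2 - γ (Ψ x')) * fderiv ℝ Ψ x' (J x') *
      fderiv ℝ Ψ x' x') (P r α) (J (P r α))) volume (0 : ℝ) (2 * Real.pi) :=
    (((hF.continuous_fderiv one_ne_zero).comp hPc).clm_apply (hJcont.comp hPc)).intervalIntegrable _ _
  have hc2 : Continuous fun α => ω ^ 2 * r ^ 2 * fderiv ℝ Ψ (P r α) (J (P r α)) ^ 2 -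
      (1 / 2 : ℝ) * (deriv γ (Ψ (P r α)) * fderiv ℝ Ψ (P r α) (P r α) *
        (fderiv ℝ Ψ (P r α) (J (P r α)) ^ 2 + fderiv ℝ Ψ (P r α) (P r α) ^ 2)) :=
    (continuous_const.mul (hΘP.pow 2)).sub
      (continuous_const.mul (((hγ'c.comp (hΨ.continuous.comp hPc)).mul hXP).mul ((hΘP.pow 2).add (hXP.pow 2))))
  have hint2 := hc2.intervalIntegrable (μ := volume) (0 : ℝ) (2 * Real.pi)
  have hint3 : IntervalIntegrable (fun α => ω ^ 2 * r ^ 2 * fderiv ℝ Ψ (P r α) (J (P r α)) ^ 2) volume (0 : ℝ) (2 * Real.pi) :=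
    (continuous_const.mul (hΘP.pow 2)).intervalIntegrable _ _
  have hint4 : IntervalIntegrable (fun α => (1 / 2 : ℝ) * (deriv γ (Ψ (P r α)) * fderiv ℝ Ψ (P r α) (P r α) *
      (fderiv ℝ Ψ (P r α) (J (P r α)) ^ 2 + fderiv ℝ Ψ (P r α) (P r α) ^ 2))) volume (0 : ℝ) (2 * Real.pi) :=
    (continuous_const.mul (((hγ'c.comp (hΨ.continuous.comp hPc)).mul hXP).mul ((hΘP.pow 2).add (hXP.pow 2)))).intervalIntegrable _ _
  rw [intervalIntegral.integral_add hint1 hint2, integral_angularDeriv_eq_zero hF hP hJ r, zero_add,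
    intervalIntegral.integral_sub hint3 hint4]

end Summit.NavierStokesRegularity.NavierStokesRegularity.Theorems.PoloidalWindowDoorPoloidalWindowRigidityZShockRotatingProfileEnergy
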